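/-
COR-CM (cell pub-hodgecm2, stage 2 of the Hodge ladder) — junction B01 `PerLFace_of_PerL`: the INDEPENDENCE TABLE of the
displayed leaves B01-L `FaceLineField` / B01-C `FaceSeesawCoupling` (`CorCM/B01/FaceSkeleton.lean`) and B01-S `FaceSupply` /
B01-O `FaceWedgeOverlap` (`CorCM/B01/FaceInputsSplit.lean`) as kernel objects.  Seat prover-pub-hodgecm2-b07 (gen 30),
2026-08-21; count-neutral calibration (no binder row; nothing under `CorCM/B01/` edited — the leaves are read BY NAME).
DEFINITION-FREE, after `CorCM/Geometry/PeriodFreeShadow.lean` (b14): the separating universes are structure updates of b14's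
`Universe.perLShadow` (`CorCM/Geometry/PerLShadow.lean`) written inside the statements.  Theorems only; nothing cited.
-/
import Summits.HodgeConjecture.CorCM.B01.FaceInputsSplitNonVacuity
import Summits.HodgeConjecture.CorCM.Geometry.PeriodFreeShadow
import Summits.HodgeConjecture.CorCM.CM.Lemmas
import HarnessLib

/-!
# B01 leaves: which implications between `PeriodThmF`, B01-L, B01-S, B01-C, B01-O are universe-uniform

Binder B01 is displayed through the kernel splits `PerLFace ⇐ FaceLineField ∧ FaceSeesawCoupling`
(`perLFace_of_PerL_of_faceInputs`) and `PerLFace ⇐ FaceSupply ∧ HeckeWedge10 ∧ FaceWedgeOverlap`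
(`Model.perLFace_of_PerL_of_supply_heckeWedge10_overlap`).  The tree knows `PeriodThmF → FaceLineField → FaceSupply` on
EVERY universe (`Universe.faceLineField_of_periodThmF`, `Universe.faceSupply_of_faceLineField` (own-b01): B01-L and B01-S
are NECESSARY; `faceSupply_of_perLFace` below is the model-universe spelling).  This file settles the remaining arrows over
ABSTRACT universes (nothing is said about the model universe of record, where each leaf is the open mathematics of ROUTES-B01):

* FULL-SUPPLY SHADOW `{ U.perLShadow with pms := fun _ _ _ _ => Sum.inr true }` (every Picard modular surface is b14's
  synthetic surface `inr true`: `H^k = ℚ × ℚ`, cup componentwise, trace = first coordinate, "morphisms" to a variety `Y`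
  of `U` = all `ℚ`-linear `H¹(Y) → ℚ × ℚ`, self-maps = identity).  Given M13 + M14 on `U` every block `U_Ψ(Γ)`, `σ ∈ Ψ`, is
  ALL of `H¹` (`fullShadow_Uiso_eq_top`); `PeriodThmF`, `FaceLineField`, `FaceSupply`, `FaceWedgeOverlap` HOLD and
  `FaceSeesawCoupling` FAILS: the (12)-wedge `(1 ⊗ (0,1)) ∪ (1 ⊗ (0,1)) ≠ 0` pairs to zero with every (34)-datum
  (`perLShadow_period_inr_eq_zero`).
* EMPTY-SUPPLY SHADOW `{ … with pms := fun _ _ _ _ => Sum.inr false }`: `U_Ψ(Γ) = ⊥`, so `FaceSeesawCoupling`,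
  `FaceWedgeOverlap` HOLD vacuously and `FaceSupply`, `FaceLineField`, `PeriodThmF` FAIL (no hypothesis on `U`).
* TRACE-FREE FULL-SUPPLY SHADOW `{ … with pms := inr true, tr := 0 }`: `FaceLineField`, `FaceSupply` HOLD, `PeriodThmF` FAILS.

CONSEQUENCES (unconditional, through `cmTypeUniverse`):
* `not_forall_periodThmF_imp_faceSeesawCoupling : ¬ ∀ U, U.PeriodThmF → U.FaceSeesawCoupling` — **B01-C is a GENUINE
  strengthening of `PerLFace`** (converse companion of `faceLineField_of_periodThmF`; kernel form of the «honest price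
  note» of `HOME/b01/ROUTES-B01.md` §3 R1 and of `HOME/pub-hodgecm2-b28/CLOSING-AUDIT-B01.md` §G; referee probe
  HOME/INBOX.md l.2695 (iv) answered in the negative);
* `not_forall_supply_wedgeOverlap_imp_faceSeesawCoupling` — the cone-fact / Hodge–Riemann hypotheses of
  `Universe.faceSeesawCoupling_of_wedgeOverlap` cannot be dropped (on the model universe they are theorems);
* `not_forall_faceSeesawCoupling_wedgeOverlap_imp_periodThmF`, `not_forall_faceLineField_imp_periodThmF`,
  `not_forall_faceSupply_imp_periodThmF` — no displayed leaf ALONE gives B01's conclusion (probe (iv), first half).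
Left open: whether `PeriodThmF → FaceWedgeOverlap` is universe-uniform (it holds on all three shadows); nothing is said
about B01-H `HeckeWedge10` (the synthetic surfaces carry an unspecified Hodge structure).
-/

noncomputable section

open scoped TensorProduct
open NumberField

namespace Summit.HodgeConjecture.CorCM

open Literature.AlgebraicGeometry.Motives (CMType HodgeStructure)
open Literature.AlgebraicGeometry.Motives.HodgeStructure (conj)
open Literature.NumberTheory.Automorphic

/-! ### Linear algebra on the synthetic plane `ℂ ⊗_ℚ (ℚ × ℚ)` -/

/-- Every element of `ℂ ⊗_ℚ (ℚ × ℚ)` is `a ⊗ (1,0) + b ⊗ (0,1)`. [folklore] -/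
theorem exists_eq_tmul_add_tmul (y : ℂ ⊗[ℚ] (ℚ × ℚ)) :
    ∃ a b : ℂ, y = a ⊗ₜ[ℚ] ((1, 0) : ℚ × ℚ) + b ⊗ₜ[ℚ] ((0, 1) : ℚ × ℚ) := by
  induction y using TensorProduct.induction_on with
  | zero => exact ⟨0, 0, by rw [TensorProduct.zero_tmul, TensorProduct.zero_tmul, add_zero]⟩
  | tmul c w =>
      obtain ⟨p, q⟩ := w
      refine ⟨p • c, q • c, ?_⟩
      have hw : ((p, q) : ℚ × ℚ) = p • ((1, 0) : ℚ × ℚ) + q • ((0, 1) : ℚ × ℚ) := by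
        ext <;> simp
      rw [hw, TensorProduct.tmul_add, TensorProduct.tmul_smul, TensorProduct.tmul_smul, TensorProduct.smul_tmul',
        TensorProduct.smul_tmul']
  | add y z hy hz =>
      obtain ⟨a, b, rfl⟩ := hy
      obtain ⟨a', b', rfl⟩ := hz
      exact ⟨a + a', b + b', by rw [TensorProduct.add_tmul, TensorProduct.add_tmul]; abel⟩

/-- A `(0,1)`-directional class `c ⊗ (0,1)` with `c ≠ 0` is non-zero (read its second coordinate). [folklore] -/
theorem tmul_zero_one_ne_zero {c : ℂ} (hc : c ≠ 0) : c ⊗ₜ[ℚ] ((0, 1) : ℚ × ℚ) ≠ 0 := by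
  intro h
  have h' := congrArg
    (fun z => TensorProduct.AlgebraTensorModule.rid ℚ ℂ ℂ ((LinearMap.snd ℚ ℚ ℚ).baseChange ℂ z)) h
  simp only [LinearMap.baseChange_tmul, LinearMap.snd_apply, TensorProduct.AlgebraTensorModule.rid_tmul, one_smul,
    map_zero] at h'
  exact hc h'

/-- On the synthetic plane (cup = componentwise product, complexified): the product of a `(0,1)`-directional class
`d ⊗ (0,1)` with ANY class is again `(0,1)`-directional. [folklore] -/
theorem exists_mulC_tmul_zero_one_eq (d : ℂ) (y : ℂ ⊗[ℚ] (ℚ × ℚ)) :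
    ∃ d' : ℂ, LinearMap.BilinMap.baseChange ℂ (LinearMap.mul ℚ (ℚ × ℚ)) (d ⊗ₜ[ℚ] ((0, 1) : ℚ × ℚ)) y =
      d' ⊗ₜ[ℚ] ((0, 1) : ℚ × ℚ) := by
  obtain ⟨a, b, rfl⟩ := exists_eq_tmul_add_tmul y
  refine ⟨d * b, ?_⟩
  simp only [map_add, LinearMap.BilinMap.baseChange_tmul, LinearMap.mul_apply', Prod.mk_mul_mk, mul_one, mul_zero,
    Prod.mk_zero_zero, TensorProduct.tmul_zero, zero_add]

namespace Universe

variable (U : Universe)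

/-- **On a synthetic surface of the PerL shadow every period whose FIRST slot is `(0,1)`-directional vanishes**
(the trace reads the first coordinate of a componentwise product with a factor of first coordinate zero). [folklore] -/
theorem perLShadow_period_inr_eq_zero (b : Bool) (ω : Fin 4 → U.perLShadow.CohC (.inr b) 1) (d : ℂ)
    (h0 : ω 0 = d ⊗ₜ[ℚ] ((0, 1) : ℚ × ℚ)) : U.perLShadow.period (.inr b) ω = 0 := by
  obtain ⟨d₁, h₁⟩ := exists_mulC_tmul_zero_one_eq d (ω 1)
  obtain ⟨d₂, h₂⟩ := exists_mulC_tmul_zero_one_eq d₁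
    (LinearMap.BilinMap.baseChange ℂ (LinearMap.mul ℚ (ℚ × ℚ)) (conj (ω 2)) (conj (ω 3)))
  show TensorProduct.AlgebraTensorModule.rid ℚ ℂ ℂ ((LinearMap.fst ℚ ℚ ℚ).baseChange ℂ
      (LinearMap.BilinMap.baseChange ℂ (LinearMap.mul ℚ (ℚ × ℚ))
        (LinearMap.BilinMap.baseChange ℂ (LinearMap.mul ℚ (ℚ × ℚ)) (ω 0) (ω 1))
        (LinearMap.BilinMap.baseChange ℂ (LinearMap.mul ℚ (ℚ × ℚ)) (conj (ω 2)) (conj (ω 3))))) = 0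
  rw [h0, h₁, h₂]
  simp only [LinearMap.baseChange_tmul, LinearMap.fst_apply, TensorProduct.tmul_zero, map_zero]

/-- M13 + M14 give, for `σ ∈ Ψ`, a non-zero holomorphic `σ`-eigen one-form `α` on `A_{(K,Ψ)}` and a rational linear
form `g` with `g_ℂ(α) = c ⊗ 1`, `c ≠ 0` (`exists_dual_baseChange_ne_zero`). [folklore] -/
theorem exists_alphaLine_dual (hE : U.Fact_eigenLine) (hA : U.Fact_alphaLine) (K : CMField) (Ψ : CMType K)
    {σ : K →+* ℂ} (hσ : σ ∈ Ψ.1) :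
    ∃ α ∈ U.alphaLine K Ψ σ, ∃ (g : U.Coh (U.cmAV K Ψ) 1 →ₗ[ℚ] ℚ) (c : ℂ), c ≠ 0 ∧
      g.baseChange ℂ α = c ⊗ₜ[ℚ] (1 : ℚ) := by
  have h1 : 0 < Module.finrank ℂ (U.eigenLine K Ψ σ) := by rw [hE K Ψ σ]; exact Nat.one_pos
  obtain ⟨⟨v, hv⟩, hv0⟩ := Module.finrank_pos_iff_exists_ne_zero.1 h1
  have hv0' : v ≠ 0 := fun h => hv0 (Subtype.ext h)
  obtain ⟨g, hg⟩ := exists_dual_baseChange_ne_zero hv0'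
  refine ⟨v, by rw [(hA K Ψ σ).1 hσ]; exact hv, g,
    TensorProduct.AlgebraTensorModule.rid ℚ ℂ ℂ (g.baseChange ℂ v),
    fun h => hg ((LinearEquiv.map_eq_zero_iff _).1 h), ?_⟩
  rw [← TensorProduct.AlgebraTensorModule.rid_symm_apply (R := ℚ) (A := ℂ) (M := ℂ), LinearEquiv.symm_apply_apply]

/-! ### The full-supply shadow: every Picard modular surface is the synthetic surface `inr true` -/

/-- **On the full-supply shadow every block `U_Ψ(Γ)` (`σ ∈ Ψ`) is ALL of `H¹ = ℂ ⊗ (ℚ × ℚ)`** (given M13 + M14 on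
`U`): the "morphisms" `inl ∘ g`, `inr ∘ g` pull `α` back to `c ⊗ (1,0)`, `c ⊗ (0,1)`, `c ≠ 0`, which span. [folklore] -/
theorem fullShadow_Uiso_eq_top (hE : U.Fact_eigenLine) (hA : U.Fact_alphaLine) {L : CMField} {ι₁ : L →+* ℂ}
    {V : HermSpace3 L ι₁} (Γ : Level V) (K : CMField) (Ψ : CMType K) {σ : K →+* ℂ} (hσ : σ ∈ Ψ.1) :
    ({ U.perLShadow with pms := fun _ _ _ _ => Sum.inr true } : Universe).Uiso Γ K Ψ σ = ⊤ := by
  obtain ⟨α, hα, g, c, hc0, hc⟩ := U.exists_alphaLine_dual hE hA K Ψ hσ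
  have hgen : ∀ e : ℚ →ₗ[ℚ] ℚ × ℚ, c ⊗ₜ[ℚ] (e 1) ∈
      ({ U.perLShadow with pms := fun _ _ _ _ => Sum.inr true } : Universe).Uiso Γ K Ψ σ := fun e => by
    refine Submodule.subset_span ⟨(e ∘ₗ g : U.Coh (U.cmAV K Ψ) 1 →ₗ[ℚ] ℚ × ℚ), α, hα, ?_⟩
    show c ⊗ₜ[ℚ] (e 1) = ((e ∘ₗ g).baseChange ℂ) α
    rw [LinearMap.baseChange_comp, LinearMap.comp_apply, hc, LinearMap.baseChange_tmul]
  have hsmul : ∀ (w : ℚ × ℚ) (a : ℂ), a ⊗ₜ[ℚ] w = (a / c) • (c ⊗ₜ[ℚ] w) := fun w a => by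
    rw [TensorProduct.smul_tmul', smul_eq_mul, div_mul_cancel₀ a hc0]
  rw [eq_top_iff]
  rintro y -
  obtain ⟨a, b, rfl⟩ := exists_eq_tmul_add_tmul y
  have h10 := hgen (LinearMap.inl ℚ ℚ ℚ)
  have h01 := hgen (LinearMap.inr ℚ ℚ ℚ)
  rw [LinearMap.inl_apply] at h10
  rw [LinearMap.inr_apply] at h01
  rw [hsmul (1, 0) a, hsmul (0, 1) b]
  exact Submodule.add_mem _ (Submodule.smul_mem _ _ h10) (Submodule.smul_mem _ _ h01)

/-- **`PeriodThmF` HOLDS on the full-supply shadow** (given M13 + M14 on `U`): all surfaces are `inr true`, where b14's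
`perLShadow_exists_period_ne_zero` gives a period `c₀ c₁ conj(c₂ c₃) ≠ 0` (`ι₁ ∈ Ψ_i` by admissibility). [folklore] -/
theorem fullShadow_periodThmF (hE : U.Fact_eigenLine) (hA : U.Fact_alphaLine) :
    ({ U.perLShadow with pms := fun _ _ _ _ => Sum.inr true } : Universe).PeriodThmF := by
  intro F _ _ f ι₁ hf V
  obtain ⟨Γ⟩ := Level.nonempty V
  obtain ⟨Fm, α, hα, hP⟩ :=
    U.perLShadow_exists_period_ne_zero hE hA F f.psi ι₁ (admissible_mem_psi f ι₁ hf) (.inr true) rfl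
  exact ⟨Γ, Fm, α, hα, hP⟩

/-- B01-L `FaceLineField` HOLDS on the full-supply shadow (given M13 + M14 on `U`). [folklore] -/
theorem fullShadow_faceLineField (hE : U.Fact_eigenLine) (hA : U.Fact_alphaLine) :
    ({ U.perLShadow with pms := fun _ _ _ _ => Sum.inr true } : Universe).FaceLineField :=
  Universe.faceLineField_of_periodThmF _ (U.fullShadow_periodThmF hE hA)

/-- B01-S `FaceSupply` HOLDS on the full-supply shadow (given M13 + M14 on `U`). [folklore] -/
theorem fullShadow_faceSupply (hE : U.Fact_eigenLine) (hA : U.Fact_alphaLine) :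
    ({ U.perLShadow with pms := fun _ _ _ _ => Sum.inr true } : Universe).FaceSupply :=
  Universe.faceSupply_of_faceLineField _ (U.fullShadow_faceLineField hE hA)

/-- **B01-O `FaceWedgeOverlap` HOLDS on the full-supply shadow** (given M13 + M14 on `U`): the non-zero (12)-wedge is
its own translate along the identity (`Γ' = Γ`) and is itself a (34)-wedge (`U_{Ψ₂}(Γ) = U_{Ψ₃}(Γ) = H¹`). [folklore] -/
theorem fullShadow_faceWedgeOverlap (hE : U.Fact_eigenLine) (hA : U.Fact_alphaLine) :
    ({ U.perLShadow with pms := fun _ _ _ _ => Sum.inr true } : Universe).FaceWedgeOverlap := by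
  intro F _ _ f ι₁ hf V Γ ω₀ ω₁ _ _ hne
  have hψ := admissible_mem_psi f ι₁ hf
  refine ⟨Γ, _, hne, Submodule.subset_span ⟨Universe.idMor _ _, ?_⟩, Submodule.subset_span ⟨ω₀, ω₁, ?_, ?_, rfl⟩⟩
  · show _ = ((LinearMap.id : (ℚ × ℚ) →ₗ[ℚ] ℚ × ℚ).baseChange ℂ) _
    rw [LinearMap.baseChange_id, LinearMap.id_apply]
  · rw [U.fullShadow_Uiso_eq_top hE hA Γ F (f.psi 2) (hψ 2)]; trivial
  · rw [U.fullShadow_Uiso_eq_top hE hA Γ F (f.psi 3) (hψ 3)]; trivial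

/-- **B01-C `FaceSeesawCoupling` FAILS on the full-supply shadow** (given M13 + M14 on `U`): at the face datum over
`ℚ(ζ₇)` of `periodThmF_binders_inhabited`, `ω₀ = ω₁ = 1 ⊗ (0,1)` lie in `U_{Ψ₀}(Γ) = U_{Ψ₁}(Γ) = H¹`, their wedge
`1 ⊗ (0,1)` is non-zero, every `P_{Γ'} → P_Γ` is the identity, and every such period vanishes. [folklore] -/
theorem fullShadow_not_faceSeesawCoupling (hE : U.Fact_eigenLine) (hA : U.Fact_alphaLine) :
    ¬ ({ U.perLShadow with pms := fun _ _ _ _ => Sum.inr true } : Universe).FaceSeesawCoupling := by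
  intro h
  obtain ⟨F, hG, h6, f, ι₁, hf, V, ⟨Γ⟩⟩ := periodThmF_binders_inhabited
  have hψ := admissible_mem_psi f ι₁ hf
  have hmem : ∀ i : Fin 4, (1 : ℂ) ⊗ₜ[ℚ] ((0, 1) : ℚ × ℚ) ∈
      ({ U.perLShadow with pms := fun _ _ _ _ => Sum.inr true } : Universe).Uiso Γ F (f.psi i) ι₁ := fun i => by
    rw [U.fullShadow_Uiso_eq_top hE hA Γ F (f.psi i) (hψ i)]; trivial
  have hne : ({ U.perLShadow with pms := fun _ _ _ _ => Sum.inr true } : Universe).cup2C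
      (({ U.perLShadow with pms := fun _ _ _ _ => Sum.inr true } : Universe).pms F ι₁ V Γ) 1
      ((1 : ℂ) ⊗ₜ[ℚ] ((0, 1) : ℚ × ℚ)) ((1 : ℂ) ⊗ₜ[ℚ] ((0, 1) : ℚ × ℚ)) ≠ 0 := by
    show LinearMap.BilinMap.baseChange ℂ (LinearMap.mul ℚ (ℚ × ℚ)) ((1 : ℂ) ⊗ₜ[ℚ] ((0, 1) : ℚ × ℚ))
      ((1 : ℂ) ⊗ₜ[ℚ] ((0, 1) : ℚ × ℚ)) ≠ 0
    simp only [LinearMap.BilinMap.baseChange_tmul, LinearMap.mul_apply', Prod.mk_mul_mk, mul_one, mul_zero]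
    exact tmul_zero_one_ne_zero one_ne_zero
  obtain ⟨Γ', g, ω₂, ω₃, -, -, hper⟩ := h F hG h6 f ι₁ hf V Γ _ _ (hmem 0) (hmem 1) hne
  apply hper
  have hg : ({ U.perLShadow with pms := fun _ _ _ _ => Sum.inr true } : Universe).pullC g 1
      ((1 : ℂ) ⊗ₜ[ℚ] ((0, 1) : ℚ × ℚ)) = (1 : ℂ) ⊗ₜ[ℚ] ((0, 1) : ℚ × ℚ) := by
    show ((LinearMap.id : (ℚ × ℚ) →ₗ[ℚ] ℚ × ℚ).baseChange ℂ) ((1 : ℂ) ⊗ₜ[ℚ] ((0, 1) : ℚ × ℚ)) = _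
    rw [LinearMap.baseChange_id, LinearMap.id_apply]
  exact U.perLShadow_period_inr_eq_zero true _ 1 (by rw [Matrix.cons_val_zero]; exact hg)

/-! ### The empty-supply shadow: every Picard modular surface is the synthetic surface `inr false` -/

/-- **On the empty-supply shadow every `U_Ψ(Γ)` is `⊥`**: all degree-one pull-backs to `inr false` vanish
(`perLShadow_pullC_inr_false`). [folklore] -/
theorem emptyShadow_Uiso_eq_bot {L : CMField} {ι₁ : L →+* ℂ} {V : HermSpace3 L ι₁} (Γ : Level V) (K : CMField)
    (Ψ : CMType K) (σ : K →+* ℂ) :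
    ({ U.perLShadow with pms := fun _ _ _ _ => Sum.inr false } : Universe).Uiso Γ K Ψ σ = ⊥ := by
  rw [eq_bot_iff]
  refine Submodule.span_le.mpr ?_
  rintro ω ⟨F, α, -, rfl⟩
  simp only [SetLike.mem_coe, Submodule.mem_bot]
  exact U.perLShadow_pullC_inr_false (Y := U.cmAV K Ψ) F α

/-- B01-C `FaceSeesawCoupling` HOLDS on the empty-supply shadow, VACUOUSLY (no non-zero (12)-wedge). [folklore] -/
theorem emptyShadow_faceSeesawCoupling :
    ({ U.perLShadow with pms := fun _ _ _ _ => Sum.inr false } : Universe).FaceSeesawCoupling := by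
  intro F _ _ f ι₁ _ V Γ ω₀ ω₁ h₀ _ hne
  rw [U.emptyShadow_Uiso_eq_bot Γ F (f.psi 0) ι₁, Submodule.mem_bot] at h₀
  exact absurd (by rw [h₀, map_zero, LinearMap.zero_apply]) hne

/-- B01-O `FaceWedgeOverlap` HOLDS on the empty-supply shadow, VACUOUSLY. [folklore] -/
theorem emptyShadow_faceWedgeOverlap :
    ({ U.perLShadow with pms := fun _ _ _ _ => Sum.inr false } : Universe).FaceWedgeOverlap := by
  intro F _ _ f ι₁ _ V Γ ω₀ ω₁ h₀ _ hne
  rw [U.emptyShadow_Uiso_eq_bot Γ F (f.psi 0) ι₁, Submodule.mem_bot] at h₀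
  exact absurd (by rw [h₀, map_zero, LinearMap.zero_apply]) hne

/-- **B01-S `FaceSupply` FAILS on the empty-supply shadow** (no hypothesis on `U`): its binder prefix is inhabited
(`ℚ(ζ₇)`) and `U_{Ψ₀}(Γ) = ⊥` contains no non-zero class. [folklore] -/
theorem emptyShadow_not_faceSupply :
    ¬ ({ U.perLShadow with pms := fun _ _ _ _ => Sum.inr false } : Universe).FaceSupply := by
  intro h
  obtain ⟨F, hG, h6, f, ι₁, hf, V, -⟩ := periodThmF_binders_inhabited
  obtain ⟨Γ, ω₀, ω₁, h₀, -, hne₀, -⟩ := h F hG h6 f ι₁ hf V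
  rw [U.emptyShadow_Uiso_eq_bot Γ F (f.psi 0) ι₁, Submodule.mem_bot] at h₀
  exact hne₀ h₀

/-- B01-L `FaceLineField` FAILS on the empty-supply shadow. [folklore] -/
theorem emptyShadow_not_faceLineField :
    ¬ ({ U.perLShadow with pms := fun _ _ _ _ => Sum.inr false } : Universe).FaceLineField :=
  fun h => U.emptyShadow_not_faceSupply (Universe.faceSupply_of_faceLineField _ h)

/-- `PeriodThmF` FAILS on the empty-supply shadow. [folklore] -/
theorem emptyShadow_not_periodThmF :
    ¬ ({ U.perLShadow with pms := fun _ _ _ _ => Sum.inr false } : Universe).PeriodThmF :=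
  fun h => U.emptyShadow_not_faceLineField (Universe.faceLineField_of_periodThmF _ h)

/-! ### The trace-free full-supply shadow: line fields without periods -/

/-- `FaceLineField` does not mention the trace (same statement on the full-supply shadow with trace `0`). [folklore] -/
theorem fullShadow_tr_zero_faceLineField_iff :
    ({ U.perLShadow with pms := fun _ _ _ _ => Sum.inr true, tr := fun _ _ => 0 } : Universe).FaceLineField ↔
      ({ U.perLShadow with pms := fun _ _ _ _ => Sum.inr true } : Universe).FaceLineField :=
  Iff.rfl

/-- B01-L HOLDS on the trace-free full-supply shadow (given M13 + M14 on `U`). [folklore] -/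
theorem fullShadow_tr_zero_faceLineField (hE : U.Fact_eigenLine) (hA : U.Fact_alphaLine) :
    ({ U.perLShadow with pms := fun _ _ _ _ => Sum.inr true, tr := fun _ _ => 0 } : Universe).FaceLineField :=
  (U.fullShadow_tr_zero_faceLineField_iff).2 (U.fullShadow_faceLineField hE hA)

/-- `PeriodThmF` FAILS on the trace-free full-supply shadow (every period vanishes, `not_periodThmF_of_tr`). [folklore] -/
theorem fullShadow_tr_zero_not_periodThmF :
    ¬ ({ U.perLShadow with pms := fun _ _ _ _ => Sum.inr true, tr := fun _ _ => 0 } : Universe).PeriodThmF :=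
  Universe.not_periodThmF_of_tr _ (fun _ _ => rfl)

/-! ### Separation statements relative to M13 + M14 on `U` -/

/-- **`PeriodThmF ∧ FaceLineField ∧ FaceSupply ∧ FaceWedgeOverlap ∧ ¬ FaceSeesawCoupling` is satisfiable** relative to
any universe with M13 + M14: the full-supply shadow. [folklore] -/
theorem exists_periodThmF_and_not_faceSeesawCoupling (hE : U.Fact_eigenLine) (hA : U.Fact_alphaLine) :
    ∃ U' : Universe, U'.PeriodThmF ∧ U'.FaceLineField ∧ U'.FaceSupply ∧ U'.FaceWedgeOverlap ∧ ¬ U'.FaceSeesawCoupling :=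
  ⟨{ U.perLShadow with pms := fun _ _ _ _ => Sum.inr true }, U.fullShadow_periodThmF hE hA,
    U.fullShadow_faceLineField hE hA, U.fullShadow_faceSupply hE hA, U.fullShadow_faceWedgeOverlap hE hA,
    U.fullShadow_not_faceSeesawCoupling hE hA⟩

/-- **`FaceLineField ∧ FaceSupply ∧ ¬ PeriodThmF` is satisfiable** relative to any universe with M13 + M14: the trace-free
full-supply shadow. [folklore] -/
theorem exists_faceLineField_and_not_periodThmF (hE : U.Fact_eigenLine) (hA : U.Fact_alphaLine) :
    ∃ U' : Universe, U'.FaceLineField ∧ U'.FaceSupply ∧ ¬ U'.PeriodThmF :=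
  ⟨{ U.perLShadow with pms := fun _ _ _ _ => Sum.inr true, tr := fun _ _ => 0 },
    U.fullShadow_tr_zero_faceLineField hE hA,
    Universe.faceSupply_of_faceLineField _ (U.fullShadow_tr_zero_faceLineField hE hA),
    U.fullShadow_tr_zero_not_periodThmF⟩

include U in
/-- **`FaceSeesawCoupling ∧ FaceWedgeOverlap ∧ ¬ FaceSupply ∧ ¬ FaceLineField ∧ ¬ PeriodThmF` is satisfiable**, for every
`U` (no hypothesis): the empty-supply shadow. [folklore] -/
theorem exists_faceSeesawCoupling_and_not_periodThmF :
    ∃ U' : Universe, U'.FaceSeesawCoupling ∧ U'.FaceWedgeOverlap ∧ ¬ U'.FaceSupply ∧ ¬ U'.FaceLineField ∧ ¬ U'.PeriodThmF :=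
  ⟨{ U.perLShadow with pms := fun _ _ _ _ => Sum.inr false }, U.emptyShadow_faceSeesawCoupling,
    U.emptyShadow_faceWedgeOverlap, U.emptyShadow_not_faceSupply, U.emptyShadow_not_faceLineField,
    U.emptyShadow_not_periodThmF⟩

end Universe

/-! ### The independence table, unconditionally (through the CM-type universe) -/

/-- **`PeriodThmF ∧ FaceLineField ∧ FaceSupply ∧ FaceWedgeOverlap ∧ ¬ FaceSeesawCoupling` is satisfiable, unconditionally**:
the full-supply shadow of the CM-type universe (`cmTypeUniverse` satisfies M13 + M14). [folklore] -/
theorem exists_periodThmF_not_faceSeesawCoupling :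
    ∃ U : Universe, U.PeriodThmF ∧ U.FaceLineField ∧ U.FaceSupply ∧ U.FaceWedgeOverlap ∧ ¬ U.FaceSeesawCoupling :=
  cmTypeUniverse.exists_periodThmF_and_not_faceSeesawCoupling cmTypeUniverse_fact_eigenLine cmTypeUniverse_fact_alphaLine

/-- **B01-C is a genuine strengthening of the face-form period theorem**: `∀ U, U.PeriodThmF → U.FaceSeesawCoupling` is
FALSE (whereas `∀ U, U.PeriodThmF → U.FaceLineField` holds, `Universe.faceLineField_of_periodThmF`): a discharge of B01-C
proves MORE than B01 needs — kernel form of the «honest price note» of ROUTES-B01.md §3 R1. [folklore] -/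
theorem not_forall_periodThmF_imp_faceSeesawCoupling : ¬ ∀ U : Universe, U.PeriodThmF → U.FaceSeesawCoupling := by
  intro h
  obtain ⟨U, hP, -, -, -, hC⟩ := exists_periodThmF_not_faceSeesawCoupling
  exact hC (h U hP)

/-- The same with the interface spelling `PerLFace` (`:= PeriodThmF`, `CorCM/Interfaces.lean`):
`∀ U, U.PerLFace → U.FaceSeesawCoupling` is FALSE. [folklore] -/
theorem not_forall_perLFace_imp_faceSeesawCoupling : ¬ ∀ U : Universe, U.PerLFace → U.FaceSeesawCoupling :=
  not_forall_periodThmF_imp_faceSeesawCoupling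

/-- **The structural hypotheses of `faceSeesawCoupling_of_wedgeOverlap` are load-bearing**:
`∀ U, U.PeriodThmF → U.FaceSupply → U.FaceWedgeOverlap → U.FaceSeesawCoupling` is FALSE — B01-O (with B01-S, even with
`PeriodThmF`) yields B01-C only on universes carrying the cone facts and Hodge–Riemann (2,0) (theorems on the model
universe: `Model.universeOf_faceSeesawCoupling_of_wedgeOverlap`). [folklore] -/
theorem not_forall_supply_wedgeOverlap_imp_faceSeesawCoupling :
    ¬ ∀ U : Universe, U.PeriodThmF → U.FaceSupply → U.FaceWedgeOverlap → U.FaceSeesawCoupling := by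
  intro h
  obtain ⟨U, hP, -, hS, hO, hC⟩ := exists_periodThmF_not_faceSeesawCoupling
  exact hC (h U hP hS hO)

/-- **`FaceSeesawCoupling ∧ FaceWedgeOverlap ∧ ¬ FaceSupply ∧ ¬ FaceLineField ∧ ¬ PeriodThmF` is satisfiable,
unconditionally**: the empty-supply shadow of the CM-type universe. [folklore] -/
theorem exists_faceSeesawCoupling_not_periodThmF :
    ∃ U : Universe, U.FaceSeesawCoupling ∧ U.FaceWedgeOverlap ∧ ¬ U.FaceSupply ∧ ¬ U.FaceLineField ∧ ¬ U.PeriodThmF :=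
  cmTypeUniverse.exists_faceSeesawCoupling_and_not_periodThmF

/-- **The conditional leaves alone do not give B01's conclusion**: `∀ U, U.FaceSeesawCoupling → U.FaceWedgeOverlap →
U.PeriodThmF` is FALSE (both hold vacuously where the supply fails) — the supply leaf B01-S / B01-L is load-bearing.
[folklore] -/
theorem not_forall_faceSeesawCoupling_wedgeOverlap_imp_periodThmF :
    ¬ ∀ U : Universe, U.FaceSeesawCoupling → U.FaceWedgeOverlap → U.PeriodThmF := by
  intro h
  obtain ⟨U, hC, hO, -, -, hP⟩ := exists_faceSeesawCoupling_not_periodThmF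
  exact hP (h U hC hO)

/-- **`FaceLineField ∧ FaceSupply ∧ ¬ PeriodThmF` is satisfiable, unconditionally**: the trace-free full-supply shadow of
the CM-type universe. [folklore] -/
theorem exists_faceLineField_not_periodThmF : ∃ U : Universe, U.FaceLineField ∧ U.FaceSupply ∧ ¬ U.PeriodThmF :=
  cmTypeUniverse.exists_faceLineField_and_not_periodThmF cmTypeUniverse_fact_eigenLine cmTypeUniverse_fact_alphaLine

/-- **B01-L alone does not give B01's conclusion**: `∀ U, U.FaceLineField → U.PeriodThmF` is FALSE — the coupling leaf
B01-C is load-bearing (with it, `faceLineField_iff_of_faceSeesawCoupling`). [folklore] -/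
theorem not_forall_faceLineField_imp_periodThmF : ¬ ∀ U : Universe, U.FaceLineField → U.PeriodThmF := by
  intro h
  obtain ⟨U, hL, -, hP⟩ := exists_faceLineField_not_periodThmF
  exact hP (h U hL)

/-- **B01-S alone does not give B01's conclusion** either: `∀ U, U.FaceSupply → U.PeriodThmF` is FALSE. [folklore] -/
theorem not_forall_faceSupply_imp_periodThmF : ¬ ∀ U : Universe, U.FaceSupply → U.PeriodThmF := by
  intro h
  obtain ⟨U, -, hS, hP⟩ := exists_faceLineField_not_periodThmF
  exact hP (h U hS)

/-- **On the model universe: `PerLFace → FaceSupply`** (B01-S is necessary for B01's conclusion, like B01-L: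
`faceLineField_of_perLFace`; through own-b01's `Universe.faceSupply_of_periodThmF`). [folklore] -/
theorem faceSupply_of_perLFace (hHD : Literature.AlgebraicGeometry.HodgeTheory.exists_isReal_hodgeModel)
    (hI : Literature.AlgebraicGeometry.HodgeTheory.hodgePQ_independent_of_hodgeModel)
    (h₁ : Literature.NumberTheory.Automorphic.PicardCM.BallQuotientUniformised)
    (h₃ : Literature.NumberTheory.Automorphic.PicardCM.CMAbelianVarietyRealised)
    (hP : (Model.picardCMUniverse hHD hI h₁ h₃).PerLFace) :
    (Model.picardCMUniverse hHD hI h₁ h₃).FaceSupply :=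
  (Model.picardCMUniverse hHD hI h₁ h₃).faceSupply_of_periodThmF hP

end Summit.HodgeConjecture.CorCM

end
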